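import Summits.ResolutionOfSingularities.ResolutionOfSingularities.Theorems.FrobeniusLadderFInjectiveMacaulayficationFiniteModificationOfBlowup
import Summits.ResolutionOfSingularities.ResolutionOfSingularities.Theorems.FrobeniusLadderFInjectiveMacaulayficationFiniteStableBlowup
import Summits.ResolutionOfSingularities.ResolutionOfSingularities.Theorems.FrobeniusLadderFInjectiveMacaulayficationFiniteModificationConductorIdeal
import HarnessLib

/-!
# S-V IS A THEOREM: the two typed inputs `ConductorIdealExists` (S-V1) and `IsBlowupOfFiniteOfStable` (S-V2) of
# `…FiniteModificationOfBlowup` hold, hence `FiniteModificationOfBlowupIsBlowup` (S-V) holds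
# (crux `FInjectiveMacaulayfication` stmt-ResolutionOfSingularities-15315, chain w45a, hole #3γ, FC′ rung r2)

[OURS · L1 W4.5a · res-D-pv-019 AS res-L1-w45a-stub-7] Support file (`--supports stmt-ResolutionOfSingularities-15315
--as helper`); NOT a statement of any manuscript; no definitions, no named facts; AI-written (AI review is weaker than
expert review). The three `@[conjecture] def`s typed by res-L1-w45a-strat-1 (`FCRungsSig.lean` v2.4 §B8, filed as
`…FiniteModificationOfBlowup` / `…FCForallExistsDimLe2`) are PROVED here, verbatim, from the generic theorems
`FiniteModificationConductor.exists_stable_idealSheaf` (uniform conductor bound + the kernel ideal sheaf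
`𝔠_N = ker(𝒪_{X₂} → g_*𝒪_{V((I𝒪_{X₃})ᴺ)})`) and `FiniteStableBlowup.isBlowup_of_finite_of_stable` (a finite
morphism inverting a stable ideal sheaf is the blowing up along it), and the sorry-free kernel
`finiteModificationOfBlowupIsBlowup_of` (Stacks 080A/080B as landed in the tree):

* `conductorIdealExists_holds : ConductorIdealExists`;
* `isBlowupOfFiniteOfStable_holds : IsBlowupOfFiniteOfStable`;
* `finiteModificationOfBlowupIsBlowup_holds : FCForallExistsDimLe2.FiniteModificationOfBlowupIsBlowup` — **a finite
  modification `X₃ → X₂ = Bl_{J₀} X₁` of a blowing up of an integral Noetherian scheme, which is a stalk isomorphism off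
  the exceptional locus, is ONE blowing up of `X₁` along an ideal sheaf `J` with `supp J = supp J₀`** (no
  quasi-projectivity of `X₁` needed).

Consequently the FC′ surface rung `fcForallExistsDimLe2_of_named` needs only Datta–Murayama Thm. B (named fact, BY NAME),
`CMLocusOpen` (EGA IV₂ 6.11.2) and S-S2 `S2Modification` (`fcForallExistsDimLe2_of_named'` below).
-/

-- single-problem summit: the doubled namespace component is forced
set_option linter.dupNamespace false

noncomputable section

open AlgebraicGeometry CategoryTheory Literature.AlgebraicGeometry.Resolution

namespace Summit.ResolutionOfSingularities.ResolutionOfSingularities.Theorems.FInjectiveMacaulayfication.FiniteModificationOfBlowup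

open Summit.ResolutionOfSingularities.ResolutionOfSingularities.Theorems.FInjectiveMacaulayfication

/-- **S-V1 holds**: the conductor-type ideal of a finite modification which is a stalk isomorphism off an effective
Cartier divisor `I` exists (`FiniteModificationConductor.exists_stable_idealSheaf`, witness
`𝔠_N = I^N · g_*𝒪_{X₃} ∩ 𝒪_{X₂}` for the uniform conductor bound `N`). [OURS, proved] -/
theorem conductorIdealExists_holds : ConductorIdealExists := by
  intro X₂ X₃ g I hint hnoeth hint₃ hfin hsurj hI hIc hiso
  haveI := hint; haveI := hnoeth; haveI := hint₃; haveI := hfin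
  exact FiniteModificationConductor.exists_stable_idealSheaf g hsurj I hI hIc hiso

/-- **S-V2 holds**: a finite surjective morphism onto an integral scheme, stalk-isomorphic off the support of a non-zero
stable ideal sheaf `𝔠` which it inverts, is the blowing up along `𝔠`
(`FiniteStableBlowup.isBlowup_of_finite_of_stable`). [OURS, proved] -/
theorem isBlowupOfFiniteOfStable_holds : IsBlowupOfFiniteOfStable := by
  intro X₂ X₃ g 𝔠 hint hint₃ hfin hsurj h𝔠 hiso hcart hstab
  haveI := hint; haveI := hfin
  exact FiniteStableBlowup.isBlowup_of_finite_of_stable g 𝔠 hsurj h𝔠 hiso hcart hstab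

/-- **S-V holds: a finite modification of a blowing up, stalk-isomorphic off the centre's support, is ONE blowing up
of the base along an ideal sheaf with the same support** (`finiteModificationOfBlowupIsBlowup_of` fed with S-V1 and
S-V2). [OURS, proved] -/
theorem finiteModificationOfBlowupIsBlowup_holds : FCForallExistsDimLe2.FiniteModificationOfBlowupIsBlowup :=
  finiteModificationOfBlowupIsBlowup_of conductorIdealExists_holds isBlowupOfFiniteOfStable_holds

/-- **The FC′ surface rung with S-V discharged**: `FCForallExistsDimLe2` from Datta–Murayama Thm. B (BY NAME),
Cohen–Macaulay openness and the S₂-modification only. [OURS assembly] -/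
theorem fcForallExistsDimLe2_of_named'
    (hDM : Literature.AlgebraicGeometry.Resolution.DattaMurayama2024_fInjectiveLocusOpen.{0})
    (hCMo : NonFullLocusClosed.CMLocusOpen) (hS2 : FCForallExistsDimLe2.S2Modification) :
    FCForallExistsDimLe2.FCForallExistsDimLe2 :=
  FCForallExistsDimLe2.fcForallExistsDimLe2_of_named hDM hCMo hS2 finiteModificationOfBlowupIsBlowup_holds

end Summit.ResolutionOfSingularities.ResolutionOfSingularities.Theorems.FInjectiveMacaulayfication.FiniteModificationOfBlowup

end
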